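import Literature.Analysis.FluidPDE.ElgindiTransportOperator
import Literature.Analysis.FluidPDE.ElgindiL2Coercivity
import HarnessLib

/-!
# `L²` coercivity of Elgindi's transport-corrected operator `𝓛_Γ^T` ([Elgindi2021] Proposition 6.4)

Topic `Literature/Analysis/FluidPDE`. Proof file (everything proved, no definitions, no named
facts) on the proof path of the named fact
`Literature.Analysis.FluidPDE.Elgindi.ElgindiGhoulMasmoudi2021_stabilityCore`
(`ElgindiStabilityDecomposition.lean`), continuing `ElgindiTransportOperator.lean` and
`ElgindiL2Coercivity.lean`. T. M. Elgindi, Ann. of Math. 194 (2021) = arXiv:1904.04795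
(`[Elgindi2021]`), §6.1 **Proposition 6.4** (p. 16 of the held text):

> `(𝓛_Γ^T(f)w, fw)_{L²} ≥ (1/5)|fw|²_{L²} − 100|D_θ f w|²_{L²}`.
> Proof. "The proof is a direct application of Proposition 5.5 and the Cauchy–Schwarz
> inequality on the last term. Indeed, `(𝓛_Γ^T(f)w, fw) = (𝓛_Γ(f)w, fw) − (ℙ((3/(1+z))D_θf)w, fw)
> ≥ ¼|fw|² − |ℙ((3/(1+z))D_θf)w||fw| ≥ (1/5)|fw|² − 5|ℙ((3/(1+z))D_θf)w|² ≥ (1/5)|fw|² −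
> 100|D_θfw|²`."

## The vendored proof (the printed one with the implicit bound on `ℙ` made explicit)

With `g = (3/(1+z))D_θf`, `ℙ(g) = g − (Γ/c)(2z²/(1+z)³)L₁₂(g)(0)`, the pairing splits as
`(𝓛_Γ^T f w, fw) = (𝓛_Γ f w, fw) − (gw, fw) + L₁₂(g)(0)·((Γ/c)(2z²/(1+z)³)w, fw)` and

* `(𝓛_Γ f w, fw) ≥ ¼|fw|²` (`l2Coercivity_opLΓ`, needs `L₁₂(f)(0) = 0`, `α ≤ 1/200`);
* `|(gw, fw)| ≤ ε₁|fw|² + (9/(4ε₁))|D_θfw|²` pointwise (`(3/(1+z))² ≤ 9`);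
* `L₁₂(g)(0)² ≤ |3Kz/(1+z)³|²_{L²(strip)}·|D_θfw|² = (27π/320)|D_θfw|²` (Cauchy–Schwarz on the
  strip, `∫₀^∞ z²/(1+z)⁶ = 1/30`, `|K|² = 9π/32`) and `((Γ/c)(2z²/(1+z)³)w, fw)² ≤
  |(Γ/c)·2/(1+z)|²_{L²(strip)}·|fw|² ≤ (2π(50/49)²)|fw|²` (`∫₀^∞ 4/(1+z)² = 4`, `|Γ|² ≤ π/2`,
  `c ≥ 49/50`), combined through `2|ab| ≤ t a² + b²/t`;

with `ε₁ = 7/200`, `t = 1/220` the constants come to `(¼ − 0.0499)|fw|² − 93.5|D_θfw|²`, inside the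
printed `(1/5, 100)`. Proved for `f ∈ C¹` compactly supported inside the open strip with
`L₁₂(f)(0) = 0` and `0 ≤ α ≤ 1/200` (the hypotheses of the vendored Prop. 5.5).

Also proved here: a square-root-free Cauchy–Schwarz inequality for Bochner integrals
(`sq_integral_mul_le`), the two radial constants, and the continuity/support of `D_θ f` for
test functions.
-/

noncomputable section

open MeasureTheory Set Function Real Filter
open _root_.Topology

namespace Literature.Analysis.FluidPDE

namespace Elgindi

/-! ### A square-root-free Cauchy–Schwarz inequality -/

/-- **Cauchy–Schwarz, squared form**: `(∫φψ)² ≤ (∫φ²)(∫ψ²)` for real functions with `φ²`, `ψ²`,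
`φψ` integrable (from `0 ≤ ∫(sφ − tψ)²` with `s = ∫φψ`, `t = ∫φ²`). [folklore] -/
theorem sq_integral_mul_le {X : Type*} [MeasurableSpace X] {μ : Measure X} {φ ψ : X → ℝ}
    (hφ : Integrable (fun x => φ x ^ 2) μ) (hψ : Integrable (fun x => ψ x ^ 2) μ)
    (hφψ : Integrable (fun x => φ x * ψ x) μ) :
    (∫ x, φ x * ψ x ∂μ) ^ 2 ≤ (∫ x, φ x ^ 2 ∂μ) * ∫ x, ψ x ^ 2 ∂μ := by
  have key : ∀ s t : ℝ, 0 ≤ s ^ 2 * (∫ x, φ x ^ 2 ∂μ) - 2 * s * t * (∫ x, φ x * ψ x ∂μ) +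
      t ^ 2 * ∫ x, ψ x ^ 2 ∂μ := by
    intro s t
    have hnn : 0 ≤ ∫ x, (s * φ x - t * ψ x) ^ 2 ∂μ := integral_nonneg fun x => sq_nonneg _
    have e : ∀ x, (s * φ x - t * ψ x) ^ 2 =
        s ^ 2 * φ x ^ 2 - 2 * s * t * (φ x * ψ x) + t ^ 2 * ψ x ^ 2 := fun x => by ring
    simp_rw [e] at hnn
    rw [integral_add, integral_sub, integral_const_mul, integral_const_mul, integral_const_mul] at hnn
    · exact hnn
    all_goals first
      | exact (hφ.const_mul _).sub (hφψ.const_mul _)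
      | exact hψ.const_mul _
      | exact hφψ.const_mul _
      | exact hφ.const_mul _
  have hΦ : 0 ≤ ∫ x, φ x ^ 2 ∂μ := integral_nonneg fun x => sq_nonneg _
  have hΨ : 0 ≤ ∫ x, ψ x ^ 2 ∂μ := integral_nonneg fun x => sq_nonneg _
  rcases hΦ.lt_or_eq with hpos | hzero
  · have h := key (∫ x, φ x * ψ x ∂μ) (∫ x, φ x ^ 2 ∂μ)
    nlinarith
  · rw [← hzero, zero_mul]
    by_contra hne
    have hC : (∫ x, φ x * ψ x ∂μ) ≠ 0 := fun h => hne (by rw [h]; norm_num)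
    set C : ℝ := ∫ x, φ x * ψ x ∂μ with hCdef
    set Ψ : ℝ := ∫ x, ψ x ^ 2 ∂μ with hΨdef
    have h := key ((Ψ + 1) / (2 * C)) 1
    rw [← hzero] at h
    have e : 2 * ((Ψ + 1) / (2 * C)) * 1 * C = Ψ + 1 := by field_simp
    rw [mul_zero, e] at h
    linarith

/-! ### Two radial constants -/

/-- `∫₀^∞ z²/(1+z)⁶ dz = 1/30` (`z² = (1+z)² − 2(1+z) + 1`; antiderivative
`−⅓(1+z)⁻³ + ½(1+z)⁻⁴ − ⅕(1+z)⁻⁵`). [folklore] -/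
theorem integral_Ioi_sq_div_one_add_pow_six : ∫ z in Ioi (0 : ℝ), z ^ 2 / (1 + z) ^ 6 = 1 / 30 := by
  have hd : ∀ z ∈ Ici (0 : ℝ), HasDerivAt (fun z : ℝ => -(1 / 3) * ((1 + z) ^ 3)⁻¹ +
      (1 / 2) * ((1 + z) ^ 4)⁻¹ - (1 / 5) * ((1 + z) ^ 5)⁻¹) (z ^ 2 / (1 + z) ^ 6) z := by
    intro z hz
    have hz1 : (1 + z) ≠ 0 := by have : (0 : ℝ) ≤ z := hz; positivity
    have h1 : HasDerivAt (fun z : ℝ => 1 + z) 1 z := by simpa using (hasDerivAt_id' z).const_add 1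
    have hp : ∀ n : ℕ, HasDerivAt (fun z : ℝ => ((1 + z) ^ n)⁻¹)
        (-(↑n * (1 + z) ^ (n - 1) * 1) / ((1 + z) ^ n) ^ 2) z := fun n =>
      (h1.fun_pow n).fun_inv (pow_ne_zero n hz1)
    have h := (((hp 3).const_mul (-(1 / 3))).add ((hp 4).const_mul (1 / 2))).sub
      ((hp 5).const_mul (1 / 5))
    refine h.congr_deriv ?_
    push_cast
    field_simp
    ring
  have ht : Tendsto (fun z : ℝ => 1 + z) atTop atTop := tendsto_atTop_add_const_left _ 1 tendsto_id
  have hl : ∀ n : ℕ, n ≠ 0 → Tendsto (fun z : ℝ => ((1 + z) ^ n)⁻¹) atTop (𝓝 0) := fun n hn =>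
    tendsto_inv_atTop_zero.comp ((tendsto_pow_atTop hn).comp ht)
  have hlim : Tendsto (fun z : ℝ => -(1 / 3) * ((1 + z) ^ 3)⁻¹ + (1 / 2) * ((1 + z) ^ 4)⁻¹ -
      (1 / 5) * ((1 + z) ^ 5)⁻¹) atTop (𝓝 0) := by
    have h := (((hl 3 (by norm_num)).const_mul (-(1 / 3))).add
      ((hl 4 (by norm_num)).const_mul (1 / 2))).sub ((hl 5 (by norm_num)).const_mul (1 / 5))
    convert h using 2
    norm_num
  rw [integral_Ioi_of_hasDerivAt_of_nonneg' hd (fun z hz => by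
    have : (0 : ℝ) < z := hz; positivity) hlim]
  norm_num

/-- `z²/(1+z)⁶` is integrable on `(0, ∞)`. [folklore] -/
theorem integrableOn_sq_div_one_add_pow_six : IntegrableOn (fun z : ℝ => z ^ 2 / (1 + z) ^ 6) (Ioi 0) := by
  have hd : ∀ z ∈ Ici (0 : ℝ), HasDerivAt (fun z : ℝ => -(1 / 3) * ((1 + z) ^ 3)⁻¹ +
      (1 / 2) * ((1 + z) ^ 4)⁻¹ - (1 / 5) * ((1 + z) ^ 5)⁻¹) (z ^ 2 / (1 + z) ^ 6) z := by
    intro z hz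
    have hz1 : (1 + z) ≠ 0 := by have : (0 : ℝ) ≤ z := hz; positivity
    have h1 : HasDerivAt (fun z : ℝ => 1 + z) 1 z := by simpa using (hasDerivAt_id' z).const_add 1
    have hp : ∀ n : ℕ, HasDerivAt (fun z : ℝ => ((1 + z) ^ n)⁻¹)
        (-(↑n * (1 + z) ^ (n - 1) * 1) / ((1 + z) ^ n) ^ 2) z := fun n =>
      (h1.fun_pow n).fun_inv (pow_ne_zero n hz1)
    have h := (((hp 3).const_mul (-(1 / 3))).add ((hp 4).const_mul (1 / 2))).sub
      ((hp 5).const_mul (1 / 5))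
    refine h.congr_deriv ?_
    push_cast
    field_simp
    ring
  have ht : Tendsto (fun z : ℝ => 1 + z) atTop atTop := tendsto_atTop_add_const_left _ 1 tendsto_id
  have hl : ∀ n : ℕ, n ≠ 0 → Tendsto (fun z : ℝ => ((1 + z) ^ n)⁻¹) atTop (𝓝 0) := fun n hn =>
    tendsto_inv_atTop_zero.comp ((tendsto_pow_atTop hn).comp ht)
  have hlim : Tendsto (fun z : ℝ => -(1 / 3) * ((1 + z) ^ 3)⁻¹ + (1 / 2) * ((1 + z) ^ 4)⁻¹ -
      (1 / 5) * ((1 + z) ^ 5)⁻¹) atTop (𝓝 0) := by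
    have h := (((hl 3 (by norm_num)).const_mul (-(1 / 3))).add
      ((hl 4 (by norm_num)).const_mul (1 / 2))).sub ((hl 5 (by norm_num)).const_mul (1 / 5))
    convert h using 2
    norm_num
  exact integrableOn_Ioi_deriv_of_nonneg' hd (fun z hz => by
    have : (0 : ℝ) < z := hz; positivity) hlim

/-- `∫₀^∞ 4/(1+z)² dz = 4`. [folklore] -/
theorem integral_Ioi_four_div_one_add_sq : ∫ z in Ioi (0 : ℝ), 4 / (1 + z) ^ 2 = 4 := by
  have hd : ∀ z ∈ Ici (0 : ℝ), HasDerivAt (fun z : ℝ => -4 * (1 + z)⁻¹) (4 / (1 + z) ^ 2) z := by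
    intro z hz
    have hz1 : (1 + z) ≠ 0 := by have : (0 : ℝ) ≤ z := hz; positivity
    have h1 : HasDerivAt (fun z : ℝ => 1 + z) 1 z := by simpa using (hasDerivAt_id' z).const_add 1
    refine ((h1.fun_inv hz1).const_mul (-4)).congr_deriv ?_
    field_simp
  have ht : Tendsto (fun z : ℝ => 1 + z) atTop atTop := tendsto_atTop_add_const_left _ 1 tendsto_id
  have hlim : Tendsto (fun z : ℝ => -4 * (1 + z)⁻¹) atTop (𝓝 0) := by
    simpa using (tendsto_inv_atTop_zero.comp ht).const_mul (-4)
  rw [integral_Ioi_of_hasDerivAt_of_nonneg' hd (fun z hz => by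
    have : (0 : ℝ) < z := hz; positivity) hlim]
  norm_num

/-- `4/(1+z)²` is integrable on `(0, ∞)`. [folklore] -/
theorem integrableOn_four_div_one_add_sq : IntegrableOn (fun z : ℝ => 4 / (1 + z) ^ 2) (Ioi 0) := by
  have h := integrableOn_inv_one_add_sq.const_mul 4
  exact IntegrableOn.congr_fun h (fun z _ => by simp [div_eq_mul_inv]) measurableSet_Ioi

/-! ### `D_θ` of a test function -/

/-- Off its topological support a function has vanishing slice derivative in `θ`. [folklore] -/
theorem deriv_slice_snd_eq_zero_of_notMem_tsupport {F : ℝ × ℝ → ℝ} {p : ℝ × ℝ}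
    (hp : p ∉ tsupport F) : deriv (fun θ => F (p.1, θ)) p.2 = 0 := by
  have h0 : F =ᶠ[𝓝 p] 0 := notMem_tsupport_iff_eventuallyEq.1 hp
  have hc : Continuous fun θ : ℝ => (p.1, θ) := by fun_prop
  have h1 : (fun θ => F (p.1, θ)) =ᶠ[𝓝 p.2] fun _ => 0 := by
    have := hc.continuousAt.tendsto.eventually (show ∀ᶠ q in 𝓝 (p.1, p.2), F q = 0 from h0)
    exact this
  rw [h1.deriv_eq]
  exact deriv_const p.2 0

/-- `D_θ f` of a `C¹` function is continuous. [folklore] -/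
theorem continuous_Dθ {f : ℝ → ℝ → ℝ} (hf : ContDiff ℝ 1 (uncurry f)) : Continuous (uncurry (Dθ f)) := by
  have hder : ∀ p : ℝ × ℝ, dθ f p.1 p.2 = fderiv ℝ (uncurry f) p (0, 1) := fun p =>
    dθ_eq_fderiv ((hf.differentiable (by norm_num)) p)
  have hDc : Continuous fun p : ℝ × ℝ => fderiv ℝ (uncurry f) p (0, 1) :=
    (hf.continuous_fderiv one_ne_zero).clm_apply continuous_const
  have h : Continuous fun p : ℝ × ℝ => Real.sin (2 * p.2) * fderiv ℝ (uncurry f) p (0, 1) := by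
    fun_prop
  refine h.congr fun p => ?_
  simp only [uncurry, Dθ_eq_mul_dθ, hder]

/-- `D_θ f` vanishes off the support of `f`. [folklore] -/
theorem Dθ_eq_zero_of_notMem_tsupport {f : ℝ → ℝ → ℝ} {p : ℝ × ℝ} (hp : p ∉ tsupport (uncurry f)) :
    Dθ f p.1 p.2 = 0 := by
  have : dθ f p.1 p.2 = 0 := deriv_slice_snd_eq_zero_of_notMem_tsupport (F := uncurry f) hp
  rw [Dθ_eq_mul_dθ, this, mul_zero]

/-! ### Proposition 6.4: the pieces -/

section Prop64

variable {α : ℝ} {f : ℝ → ℝ → ℝ} (hf : ContDiff ℝ 1 (uncurry f)) (hs : HasCompactSupport (uncurry f))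
  (hsub : tsupport (uncurry f) ⊆ strip)

include hf hs hsub

/-- `(F·w)²` is integrable on the strip for `F` continuous on the strip and vanishing off the
support of the test function `f`. [folklore] -/
theorem integrableOn_sq_mul_radialWeight {F : ℝ × ℝ → ℝ} (hF : ContinuousOn F strip)
    (hF0 : ∀ p, p ∉ tsupport (uncurry f) → F p = 0) :
    IntegrableOn (fun p : ℝ × ℝ => (F p * radialWeight p.1) ^ 2) strip := by
  have _ := hf
  have hwon : ContinuousOn (fun p : ℝ × ℝ => radialWeight p.1) strip := by
    unfold radialWeight
    exact ContinuousOn.div (by fun_prop) (by fun_prop) fun p hp => pow_ne_zero 2 (ne_of_gt hp.1)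
  have e : (fun p : ℝ × ℝ => (F p * radialWeight p.1) ^ 2) = fun p => F p * (F p * radialWeight p.1 ^ 2) := by
    funext p; ring
  rw [e]
  have hFs : HasCompactSupport F := HasCompactSupport.intro hs fun p hp => hF0 p hp
  refine (Continuous.integrable_of_hasCompactSupport ?_ hFs.mul_right).integrableOn
  exact continuous_of_continuousOn_strip (isClosed_tsupport _) hsub (hF.mul (hF.mul (hwon.pow 2)))
    fun p hp => by simp [hF0 p hp]

/-- **The transport pairing**: `|∬ (3/(1+z))D_θf · f · w²| ≤ (7/200)∬(fw)² + (450/7)∬(D_θf·w)²`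
(`2·3|ab| ≤ (7/100)·… `, i.e. `ε₁ = 7/200`). [folklore] -/
theorem abs_integral_transport_pairing_le :
    |∫ p in strip, 3 / (1 + p.1) * Dθ f p.1 p.2 * f p.1 p.2 * radialWeight p.1 ^ 2| ≤
      (7 / 200) * (∫ p in strip, (f p.1 p.2 * radialWeight p.1) ^ 2) +
        (450 / 7) * ∫ p in strip, (Dθ f p.1 p.2 * radialWeight p.1) ^ 2 := by
  have hf0 : ∀ p : ℝ × ℝ, p ∉ tsupport (uncurry f) → f p.1 p.2 = 0 := fun p hp =>
    (image_eq_zero_of_notMem_tsupport hp : uncurry f p = 0)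
  have hD0 : ∀ p : ℝ × ℝ, p ∉ tsupport (uncurry f) → Dθ f p.1 p.2 = 0 := fun p hp =>
    Dθ_eq_zero_of_notMem_tsupport hp
  have hiA := integrableOn_sq_mul_radialWeight hf hs hsub (F := fun p => f p.1 p.2)
    hf.continuous.continuousOn hf0
  have hiY := integrableOn_sq_mul_radialWeight hf hs hsub (F := fun p => Dθ f p.1 p.2)
    (continuous_Dθ hf).continuousOn hD0
  refine abs_integral_le_integral_abs.trans ?_
  have h : ∫ p in strip, |3 / (1 + p.1) * Dθ f p.1 p.2 * f p.1 p.2 * radialWeight p.1 ^ 2| ≤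
      ∫ p in strip, ((7 / 200) * (f p.1 p.2 * radialWeight p.1) ^ 2 +
        (450 / 7) * (Dθ f p.1 p.2 * radialWeight p.1) ^ 2) := by
    refine integral_mono_of_nonneg (Eventually.of_forall fun p => abs_nonneg _)
      ((hiA.const_mul _).add (hiY.const_mul _)) ?_
    rw [EventuallyLE, ae_restrict_iff' measurableSet_strip]
    refine Eventually.of_forall fun p hp => ?_
    have hz : (0 : ℝ) < p.1 := hp.1
    have e : 3 / (1 + p.1) * Dθ f p.1 p.2 * f p.1 p.2 * radialWeight p.1 ^ 2 =
        (3 / (1 + p.1)) * ((Dθ f p.1 p.2 * radialWeight p.1) * (f p.1 p.2 * radialWeight p.1)) := by ring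
    have h3 : |3 / (1 + p.1)| ≤ 3 := by
      rw [abs_of_pos (by positivity), div_le_iff₀ (by positivity)]
      nlinarith
    rw [e, abs_mul, abs_mul]
    have hsq1 : (f p.1 p.2 * radialWeight p.1) ^ 2 = |f p.1 p.2 * radialWeight p.1| ^ 2 := (sq_abs _).symm
    have hsq2 : (Dθ f p.1 p.2 * radialWeight p.1) ^ 2 = |Dθ f p.1 p.2 * radialWeight p.1| ^ 2 :=
      (sq_abs _).symm
    rw [hsq1, hsq2]
    have hu0 := abs_nonneg (Dθ f p.1 p.2 * radialWeight p.1)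
    have hv0 := abs_nonneg (f p.1 p.2 * radialWeight p.1)
    have huv : |3 / (1 + p.1)| * (|Dθ f p.1 p.2 * radialWeight p.1| * |f p.1 p.2 * radialWeight p.1|) ≤
        3 * (|Dθ f p.1 p.2 * radialWeight p.1| * |f p.1 p.2 * radialWeight p.1|) :=
      mul_le_mul_of_nonneg_right h3 (mul_nonneg hu0 hv0)
    nlinarith [sq_nonneg ((7 / 200) * |f p.1 p.2 * radialWeight p.1| -
      (3 / 2) * |Dθ f p.1 p.2 * radialWeight p.1|)]
  rw [integral_add (hiA.const_mul _) (hiY.const_mul _), integral_const_mul, integral_const_mul] at h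
  exact h

/-- **The projector coefficient**: `L₁₂((3/(1+z))D_θf)(0)² ≤ (27π/320)·∬(D_θf·w)²`
(Cauchy–Schwarz on the strip against `3Kz/(1+z)³`, `∫₀^∞z²/(1+z)⁶ = 1/30`, `|K|² = 9π/32`). [folklore] -/
theorem sq_L12_transport_le :
    L12 (fun z θ => 3 / (1 + z) * Dθ f z θ) 0 ^ 2 ≤
      27 * π / 320 * ∫ p in strip, (Dθ f p.1 p.2 * radialWeight p.1) ^ 2 := by
  have hD0 : ∀ p : ℝ × ℝ, p ∉ tsupport (uncurry f) → Dθ f p.1 p.2 = 0 := fun p hp =>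
    Dθ_eq_zero_of_notMem_tsupport hp
  have hDon : ContinuousOn (fun p : ℝ × ℝ => Dθ f p.1 p.2) strip := (continuous_Dθ hf).continuousOn
  set m : ℝ × ℝ → ℝ := fun p => 3 * kernelK p.2 * p.1 / (1 + p.1) ^ 3 with hm
  set u : ℝ × ℝ → ℝ := fun p => Dθ f p.1 p.2 * radialWeight p.1 with hu
  have hM2 : ∫ p in strip, m p ^ 2 = 27 * π / 320 := by
    have e : ∀ p ∈ strip, m p ^ 2 = (p.1 ^ 2 / (1 + p.1) ^ 6) * (9 * kernelK p.2 ^ 2) := by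
      intro p hp
      have : (0 : ℝ) < p.1 := hp.1
      simp only [hm]
      field_simp
      ring
    rw [setIntegral_congr_fun measurableSet_strip e, volume_restrict_strip,
      integral_prod_mul (f := fun z : ℝ => z ^ 2 / (1 + z) ^ 6) (g := fun θ : ℝ => 9 * kernelK θ ^ 2),
      integral_Ioi_sq_div_one_add_pow_six, integral_const_mul, setIntegral_kernelK_sq]
    ring
  have im2 : IntegrableOn (fun p => m p ^ 2) strip := by
    have h1 : Integrable (fun z : ℝ => z ^ 2 / (1 + z) ^ 6) (volume.restrict (Ioi 0)) :=
      integrableOn_sq_div_one_add_pow_six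
    have h2 : Integrable (fun θ : ℝ => 9 * kernelK θ ^ 2) (volume.restrict (Ioo 0 (π / 2))) :=
      ((continuous_const.mul (continuous_kernelK.pow 2)).integrableOn_Icc (a := 0)
        (b := π / 2)).mono_set Ioo_subset_Icc_self
    have h := h1.mul_prod h2
    rw [← volume_restrict_strip] at h
    refine IntegrableOn.congr_fun h (fun p hp => ?_) measurableSet_strip
    have : (0 : ℝ) < p.1 := hp.1
    simp only [hm]
    field_simp
    ring
  have hgon : ContinuousOn (fun p : ℝ × ℝ => 3 / (1 + p.1) * Dθ f p.1 p.2) strip := by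
    refine (ContinuousOn.div continuousOn_const (by fun_prop) fun p hp => ?_).mul hDon
    have : (0 : ℝ) < p.1 := hp.1; positivity
  have hgi : IntegrableOn (l12Integrand fun z θ => 3 / (1 + z) * Dθ f z θ) strip := by
    have hc' : Continuous (l12Integrand fun z θ => 3 / (1 + z) * Dθ f z θ) := by
      refine continuous_of_continuousOn_strip (isClosed_tsupport _) hsub ?_ fun p hp => by
        simp [hD0 p hp]
      change ContinuousOn (fun p : ℝ × ℝ => 3 / (1 + p.1) * Dθ f p.1 p.2 * kernelK p.2 / p.1) strip
      exact (hgon.mul (continuous_kernelK.comp continuous_snd).continuousOn).div continuousOn_fst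
        fun p hp => ne_of_gt hp.1
    exact (hc'.integrable_of_hasCompactSupport
      (HasCompactSupport.intro hs fun p hp => by simp [hD0 p hp])).integrableOn
  have hum : ∀ p ∈ strip, l12Integrand (fun z θ => 3 / (1 + z) * Dθ f z θ) p = u p * m p := by
    intro p hp
    have hz : p.1 ≠ 0 := ne_of_gt hp.1
    have hz' : (0 : ℝ) < p.1 := hp.1
    simp only [l12Integrand_apply, hu, hm]
    unfold radialWeight
    field_simp
  have hℓ₀eq : L12 (fun z θ => 3 / (1 + z) * Dθ f z θ) 0 = ∫ p in strip, u p * m p := by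
    rw [L12_zero_eq_setIntegral hgi]
    exact setIntegral_congr_fun measurableSet_strip hum
  have ium : IntegrableOn (fun p => u p * m p) strip := hgi.congr_fun hum measurableSet_strip
  have iu2 : IntegrableOn (fun p => u p ^ 2) strip :=
    integrableOn_sq_mul_radialWeight hf hs hsub (F := fun p => Dθ f p.1 p.2) hDon hD0
  rw [hℓ₀eq, ← hM2, mul_comm]
  exact sq_integral_mul_le iu2 im2 ium

/-- **The projector profile pairing**: `(∬ (Γ/c)(2z²/(1+z)³)·f·w²)² ≤ 2π(50/49)²·∬(fw)²` for
`0 ≤ α ≤ 1/200` (Cauchy–Schwarz, `∫₀^∞4/(1+z)² = 4`, `|Γ|² ≤ π/2`, `c ≥ 49/50`). [folklore] -/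
theorem sq_integral_projKernel_pairing_le (hα : 0 ≤ α) (hα' : α ≤ 1 / 200) :
    (∫ p in strip, projKernel α p.1 p.2 * f p.1 p.2 * radialWeight p.1 ^ 2) ^ 2 ≤
      (2 * π * (50 / 49) ^ 2) * ∫ p in strip, (f p.1 p.2 * radialWeight p.1) ^ 2 := by
  have hcpos : 0 < profileConst α := profileConst_pos hα
  have hc49 : (49 / 50 : ℝ) ≤ profileConst α := profileConst_ge hα hα'
  have hΓc : Continuous (angularWeight α) := continuous_angularWeight hα
  have hf0 : ∀ p : ℝ × ℝ, p ∉ tsupport (uncurry f) → f p.1 p.2 = 0 := fun p hp =>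
    (image_eq_zero_of_notMem_tsupport hp : uncurry f p = 0)
  set n : ℝ × ℝ → ℝ := fun p => projKernel α p.1 p.2 * radialWeight p.1 with hn
  set v : ℝ × ℝ → ℝ := fun p => f p.1 p.2 * radialWeight p.1 with hv
  have en : ∀ p ∈ strip, n p ^ 2 = (4 / (1 + p.1) ^ 2) * (angularWeight α p.2 / profileConst α) ^ 2 := by
    intro p hp
    have : (0 : ℝ) < p.1 := hp.1
    simp only [hn, projKernel]
    unfold radialWeight
    field_simp
    ring
  have hN2 : ∫ p in strip, n p ^ 2 = 4 * ∫ θ in Ioo 0 (π / 2), (angularWeight α θ / profileConst α) ^ 2 := by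
    rw [setIntegral_congr_fun measurableSet_strip en, volume_restrict_strip,
      integral_prod_mul (f := fun z : ℝ => 4 / (1 + z) ^ 2)
        (g := fun θ : ℝ => (angularWeight α θ / profileConst α) ^ 2), integral_Ioi_four_div_one_add_sq]
  have hI2 : IntegrableOn (fun θ => (angularWeight α θ / profileConst α) ^ 2) (Ioo 0 (π / 2)) :=
    (((hΓc.div_const _).pow 2).integrableOn_Icc (a := 0) (b := π / 2)).mono_set Ioo_subset_Icc_self
  have hΓ2 : ∫ θ in Ioo 0 (π / 2), (angularWeight α θ / profileConst α) ^ 2 ≤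
      (π / 2) * (1 / profileConst α ^ 2) := by
    have hI' : IntegrableOn (fun _ : ℝ => (1 / profileConst α ^ 2 : ℝ)) (Ioo 0 (π / 2)) :=
      (continuous_const.integrableOn_Icc (a := 0) (b := π / 2)).mono_set Ioo_subset_Icc_self
    have hb : ∀ θ ∈ Ioo 0 (π / 2), (angularWeight α θ / profileConst α) ^ 2 ≤ 1 / profileConst α ^ 2 := by
      intro θ hθ
      have h0 : 0 ≤ angularWeight α θ := angularWeight_nonneg α (Ioo_subset_Icc_self hθ)
      have h1 : angularWeight α θ ≤ 1 := angularWeight_le_one hα (Ioo_subset_Icc_self hθ)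
      rw [div_pow]
      exact div_le_div_of_nonneg_right (pow_le_one₀ h0 h1) (by positivity)
    calc ∫ θ in Ioo 0 (π / 2), (angularWeight α θ / profileConst α) ^ 2
        ≤ ∫ θ in Ioo 0 (π / 2), (1 / profileConst α ^ 2 : ℝ) :=
          setIntegral_mono_on hI2 hI' measurableSet_Ioo hb
      _ = (π / 2) * (1 / profileConst α ^ 2) := by
          rw [setIntegral_const, Real.volume_real_Ioo_of_le (by positivity), smul_eq_mul, sub_zero]
  have in2 : IntegrableOn (fun p => n p ^ 2) strip := by
    have h1 : Integrable (fun z : ℝ => 4 / (1 + z) ^ 2) (volume.restrict (Ioi 0)) :=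
      integrableOn_four_div_one_add_sq
    have h := h1.mul_prod (hI2 : Integrable _ (volume.restrict (Ioo 0 (π / 2))))
    rw [← volume_restrict_strip] at h
    exact IntegrableOn.congr_fun h (fun p hp => (en p hp).symm) measurableSet_strip
  have hwon : ContinuousOn (fun p : ℝ × ℝ => radialWeight p.1) strip := by
    unfold radialWeight
    exact ContinuousOn.div (by fun_prop) (by fun_prop) fun p hp => pow_ne_zero 2 (ne_of_gt hp.1)
  have hPon : ContinuousOn (fun p : ℝ × ℝ => projKernel α p.1 p.2) strip := by
    unfold projKernel
    refine ((hΓc.comp continuous_snd).continuousOn.div_const _).mul ?_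
    exact ContinuousOn.div (by fun_prop) (by fun_prop) fun p hp => by
      have : (0 : ℝ) < p.1 := hp.1; positivity
  have inv : IntegrableOn (fun p => n p * v p) strip := by
    have hc' : Continuous fun p : ℝ × ℝ => n p * v p := by
      refine continuous_of_continuousOn_strip (isClosed_tsupport _) hsub ?_ fun p hp => by
        simp [hv, hf0 p hp]
      exact (hPon.mul hwon).mul (hf.continuous.continuousOn.mul hwon)
    exact (hc'.integrable_of_hasCompactSupport (HasCompactSupport.intro hs fun p hp => by
      simp [hv, hf0 p hp])).integrableOn
  have iv2 : IntegrableOn (fun p => v p ^ 2) strip :=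
    integrableOn_sq_mul_radialWeight hf hs hsub (F := fun p => f p.1 p.2) hf.continuous.continuousOn hf0
  have hJeq : ∫ p in strip, projKernel α p.1 p.2 * f p.1 p.2 * radialWeight p.1 ^ 2 =
      ∫ p in strip, n p * v p :=
    setIntegral_congr_fun measurableSet_strip fun p _ => by simp only [hn, hv]; ring
  have hA0 : 0 ≤ ∫ p in strip, v p ^ 2 := integral_nonneg fun p => sq_nonneg _
  have hc2 : 1 / profileConst α ^ 2 ≤ 1 / (49 / 50 : ℝ) ^ 2 := by
    apply one_div_le_one_div_of_le (by norm_num)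
    exact pow_le_pow_left₀ (by norm_num) hc49 2
  have hN : ∫ p in strip, n p ^ 2 ≤ 2 * π * (50 / 49) ^ 2 := by
    rw [hN2]
    nlinarith [hΓ2, hc2, pi_pos]
  rw [hJeq]
  calc (∫ p in strip, n p * v p) ^ 2 ≤ (∫ p in strip, n p ^ 2) * ∫ p in strip, v p ^ 2 :=
        sq_integral_mul_le in2 iv2 inv
    _ ≤ (2 * π * (50 / 49) ^ 2) * ∫ p in strip, v p ^ 2 := mul_le_mul_of_nonneg_right hN hA0

/-- **The splitting** `∬𝓛_Γ^T(f)·f·w² = ∬𝓛_Γ(f)·f·w² − ∬(3/(1+z))D_θf·f·w² + L₁₂((3/(1+z))D_θf)(0)·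
∬(Γ/c)(2z²/(1+z)³)·f·w²` (`α ≥ 0`; all three integrands are continuous with compact support). [folklore] -/
theorem integral_opLΓT_pairing_eq (hα : 0 ≤ α) :
    ∫ p in strip, opLΓT α f p.1 p.2 * f p.1 p.2 * radialWeight p.1 ^ 2 =
      (∫ p in strip, opLΓ α f p.1 p.2 * f p.1 p.2 * radialWeight p.1 ^ 2) -
        (∫ p in strip, 3 / (1 + p.1) * Dθ f p.1 p.2 * f p.1 p.2 * radialWeight p.1 ^ 2) +
        L12 (fun z θ => 3 / (1 + z) * Dθ f z θ) 0 *
          ∫ p in strip, projKernel α p.1 p.2 * f p.1 p.2 * radialWeight p.1 ^ 2 := by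
  have hcpos : 0 < profileConst α := profileConst_pos hα
  have hΓc : Continuous (angularWeight α) := continuous_angularWeight hα
  have hf0 : ∀ p : ℝ × ℝ, p ∉ tsupport (uncurry f) → f p.1 p.2 = 0 := fun p hp =>
    (image_eq_zero_of_notMem_tsupport hp : uncurry f p = 0)
  have hKcl : IsClosed (tsupport (uncurry f)) := isClosed_tsupport _
  have hwon : ContinuousOn (fun p : ℝ × ℝ => radialWeight p.1) strip := by
    unfold radialWeight
    exact ContinuousOn.div (by fun_prop) (by fun_prop) fun p hp => pow_ne_zero 2 (ne_of_gt hp.1)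
  have hfon : ContinuousOn (fun p : ℝ × ℝ => f p.1 p.2) strip := hf.continuous.continuousOn
  have hDon : ContinuousOn (fun p : ℝ × ℝ => Dθ f p.1 p.2) strip := (continuous_Dθ hf).continuousOn
  have hgon : ContinuousOn (fun p : ℝ × ℝ => 3 / (1 + p.1) * Dθ f p.1 p.2) strip := by
    refine (ContinuousOn.div continuousOn_const (by fun_prop) fun p hp => ?_).mul hDon
    have : (0 : ℝ) < p.1 := hp.1; positivity
  have hPon : ContinuousOn (fun p : ℝ × ℝ => projKernel α p.1 p.2) strip := by
    unfold projKernel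
    refine ((hΓc.comp continuous_snd).continuousOn.div_const _).mul ?_
    exact ContinuousOn.div (by fun_prop) (by fun_prop) fun p hp => by
      have : (0 : ℝ) < p.1 := hp.1; positivity
  have hLc : Continuous (L12 f) := continuous_L12 hf.continuous hs hsub
  have hopL : ContinuousOn (fun p : ℝ × ℝ => opL f p.1 p.2) strip := by
    have hdz : ContinuousOn (fun p : ℝ × ℝ => Dz f p.1 p.2) strip :=
      (continuous_fst.mul (continuous_dz hf)).continuousOn
    have h3 : ContinuousOn (fun p : ℝ × ℝ => 2 * f p.1 p.2 / (1 + p.1)) strip :=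
      (continuousOn_const.mul hfon).div (by fun_prop) fun p hp => by
        have : (0 : ℝ) < p.1 := hp.1; positivity
    exact ((hfon.add hdz).sub h3).congr fun p _ => by
      simp only [Pi.add_apply, Pi.sub_apply, opL_apply]
  have hcoef : ContinuousOn (fun p : ℝ × ℝ =>
      2 * p.1 * angularWeight α p.2 / (profileConst α * (1 + p.1) ^ 2) * L12 f p.1) strip := by
    refine (ContinuousOn.div ?_ (by fun_prop) fun p hp => ?_).mul (hLc.comp continuous_fst).continuousOn
    · exact ((continuous_const.mul continuous_fst).mul (hΓc.comp continuous_snd)).continuousOn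
    · have : (0 : ℝ) < p.1 := hp.1
      exact mul_ne_zero hcpos.ne' (by positivity)
  have hLΓ : ContinuousOn (fun p : ℝ × ℝ => opLΓ α f p.1 p.2) strip :=
    (hopL.sub hcoef).congr fun p _ => by simp only [Pi.sub_apply, opLΓ_apply]
  -- integrability of the three pairings (continuous on the strip, zero off `tsupport f`)
  have hint : ∀ {G : ℝ × ℝ → ℝ}, ContinuousOn G strip →
      IntegrableOn (fun p : ℝ × ℝ => G p * f p.1 p.2 * radialWeight p.1 ^ 2) strip := by
    intro G hG
    have hc' : Continuous fun p : ℝ × ℝ => G p * f p.1 p.2 * radialWeight p.1 ^ 2 :=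
      continuous_of_continuousOn_strip hKcl hsub ((hG.mul hfon).mul (hwon.pow 2))
        fun p hp => by simp [hf0 p hp]
    exact (hc'.integrable_of_hasCompactSupport (HasCompactSupport.intro hs fun p hp => by
      simp [hf0 p hp])).integrableOn
  have i1 := hint hLΓ
  have i2 := hint hgon
  have i3 := hint hPon
  have hsplitf : ∀ p : ℝ × ℝ, opLΓT α f p.1 p.2 * f p.1 p.2 * radialWeight p.1 ^ 2 =
      opLΓ α f p.1 p.2 * f p.1 p.2 * radialWeight p.1 ^ 2 -
        3 / (1 + p.1) * Dθ f p.1 p.2 * f p.1 p.2 * radialWeight p.1 ^ 2 +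
        L12 (fun z θ => 3 / (1 + z) * Dθ f z θ) 0 *
          (projKernel α p.1 p.2 * f p.1 p.2 * radialWeight p.1 ^ 2) := by
    intro p
    rw [opLΓT_apply, projP]
    ring
  rw [setIntegral_congr_fun measurableSet_strip fun p _ => hsplitf p, integral_add, integral_sub,
    integral_const_mul]
  all_goals first
    | exact i1
    | exact i2
    | exact i1.sub i2
    | exact (i3.const_mul _)

end Prop64

/-! ### Proposition 6.4 -/

/-- **`L²` coercivity of `𝓛_Γ^T`** (Elgindi 2021, Proposition 6.4: "`(𝓛_Γ^T(f)w, fw)_{L²} ≥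
(1/5)|fw|²_{L²} − 100|D_θ f w|²_{L²}`"), for `0 ≤ α ≤ 1/200` and `f ∈ C¹` compactly supported inside
the open quarter strip with `L₁₂(f)(0) = 0`:
`(1/5)∬_strip(fw)² − 100∬_strip(D_θf·w)² ≤ ∬_strip 𝓛_Γ^T(f)·f·w²`. Printed proof ("a direct
application of Proposition 5.5 and the Cauchy–Schwarz inequality on the last term") with the
bound on the projector term made explicit, see the module docstring. [cite: Elgindi2021, §6.1 Proposition 6.4 (p. 16 of arXiv:1904.04795)] -/
theorem transportL2Coercivity {α : ℝ} (hα : 0 ≤ α) (hα' : α ≤ 1 / 200) {f : ℝ → ℝ → ℝ}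
    (hf : ContDiff ℝ 1 (uncurry f)) (hs : HasCompactSupport (uncurry f))
    (hsub : tsupport (uncurry f) ⊆ strip) (hL0 : L12 f 0 = 0) :
    (1 / 5) * (∫ p in strip, (f p.1 p.2 * radialWeight p.1) ^ 2) -
        100 * ∫ p in strip, (Dθ f p.1 p.2 * radialWeight p.1) ^ 2 ≤
      ∫ p in strip, opLΓT α f p.1 p.2 * f p.1 p.2 * radialWeight p.1 ^ 2 := by
  rw [integral_opLΓT_pairing_eq hf hs hsub hα]
  set A : ℝ := ∫ p in strip, (f p.1 p.2 * radialWeight p.1) ^ 2 with hA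
  set Y2 : ℝ := ∫ p in strip, (Dθ f p.1 p.2 * radialWeight p.1) ^ 2 with hY2
  set I1 : ℝ := ∫ p in strip, opLΓ α f p.1 p.2 * f p.1 p.2 * radialWeight p.1 ^ 2 with hI1
  set I2 : ℝ := ∫ p in strip, 3 / (1 + p.1) * Dθ f p.1 p.2 * f p.1 p.2 * radialWeight p.1 ^ 2 with hI2
  set ℓ₀ : ℝ := L12 (fun z θ => 3 / (1 + z) * Dθ f z θ) 0 with hℓ₀
  set J : ℝ := ∫ p in strip, projKernel α p.1 p.2 * f p.1 p.2 * radialWeight p.1 ^ 2 with hJ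
  have h1 : (1 / 4) * A ≤ I1 := l2Coercivity_opLΓ hα hα' hf hs hsub hL0
  have h2 : |I2| ≤ (7 / 200) * A + (450 / 7) * Y2 := abs_integral_transport_pairing_le hf hs hsub
  have h3 : ℓ₀ ^ 2 ≤ 27 * π / 320 * Y2 := sq_L12_transport_le hf hs hsub
  have h4 : J ^ 2 ≤ (2 * π * (50 / 49) ^ 2) * A := sq_integral_projKernel_pairing_le hf hs hsub hα hα'
  have hA0 : 0 ≤ A := integral_nonneg fun p => sq_nonneg _
  have hY0 : 0 ≤ Y2 := integral_nonneg fun p => sq_nonneg _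
  have hπ := Real.pi_lt_d4
  have hπA : π * A ≤ 3.1416 * A := mul_le_mul_of_nonneg_right hπ.le hA0
  have hπY : π * Y2 ≤ 3.1416 * Y2 := mul_le_mul_of_nonneg_right hπ.le hY0
  have hprod : -(ℓ₀ * J) ≤ J ^ 2 / 440 + 110 * ℓ₀ ^ 2 := by
    nlinarith [sq_nonneg (J + 220 * ℓ₀)]
  have h2' := (abs_le.1 h2).2
  nlinarith [h1, h2', hprod, h4, h3, hπA, hπY, hA0, hY0]

end Elgindi

end Literature.Analysis.FluidPDE
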